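/-
Origin: expansion seat `planner-pub-hodgecm-pv14-g3-0`, handover #3 2026-08-18T05:40:35Z (`HOME/pub-hodgecm-pv14-g3/lean/Pv14g3/PerL34/P43KTypesFock.lean`, md5 959f3c64, 329 lines);
landed by the gen-6 packager in gate run 23 as `HodgeCM/PerL34/P43_KTypesFock.lean` (import ^import Pv14g3\.PerL34\.P43KTypesU2Gen\b→import HodgeCM.PerL34.P43_KTypesU2Gen ×1).
-/
/-
Origin: HOME/pub-hodgecm-pv14-g3/lean/Pv14g3/PerL34/P43KTypesFock.lean — session planner-pub-hodgecm-pv14-g3-0 (unit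
pub-hodgecm-pv14-g3, DAG-NODE PROVER #14 gen 3).  Intended final place: `HodgeCM/PerL34/P43_KTypesFock.lean`, after
`P43_KTypesU2Gen.lean` (this seat) and the LANDED `FockKTypes.lean` (pv12, run 20).  On landing rewrite the import
`Pv14g3.PerL34.P43KTypesU2Gen` ↦ `HodgeCM.PerL34.P43_KTypesU2Gen`.  DAG node **N33b** (PerL v5 Prop 4.3 proof, input
(X1), tex ll. 650–652: "annihilated by `𝔭₋` (… archimedean component `J⁺ ⊠ 𝟏` … `𝔭₊` is the lowest `K_{ι₁}`-type
of `J⁺`)").  Nothing cited, nothing asserted.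
-/
import Summits.HodgeConjecture.HodgeCM.PerL34.P43_KTypesU2Gen
import Summits.HodgeConjecture.HodgeCM.PerL34.FockKTypes

set_option autoImplicit false

/-!
# N33b (X1), concrete `K_{ι₁}`-types III: `F_{0,0}`, `F_{1,1}` do not occur in `J⁺` — the leaves `h₀ h₁` from the Fock model

The X1 bridge (`P43X1Bridge.thetaPKilledByPminus_of_KTypes`, concretely `P43KTypesU2.thetaPKilledByPminus_of_U2`)
has the two Schur leaves
`h₀ : NoEmbedding ℂ[K] F00.asModule N`, `h₁ : NoEmbedding ℂ[K] F11.asModule N`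
("neither the trivial `K_{ι₁}`-type `F_{0,0}` nor `F_{1,1} = sl₂` occurs in the `(𝔤,K)`-module `N` of
`Θ_i(χ'_i)`"), so far labelled PRINT [BW VI 4.11 with (9)] (`J_{1,0}` contains `F_{1,0}` and no other `F_{p,q}`)
+ INPUT N31 (every constituent has archimedean component `J⁺ = J_{1,0}`).

This file proves the `K`-type half in the kernel, in pv12's EXPLICIT Fock model `Fock.HarmModel = ℂ[z₁,z₂,w]` of the
pair `(U(2,1), U(1))` (`FockKTypes.lean`, weight table (F2): `z_a ↦ (e_a;0)`, `w ↦ (0;−1)`, vacuum `(0,0;−1)`):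

* `fockRep : Representation ℂ K Fock.HarmModel` — the `K = U(2) × U(1)`-GROUP action by substitution,
  `((A,d)·f)(z,w) = d̄ · f(zA, d̄w)` (so `z_a` has `U(2)`-weight `e_a`, `w` has `U(1)_V`-weight `−1`, and the
  vacuum twist is `d̄ = (0,0;−1)`); on monomials the diagonal torus acts by the character
  `fockRep_diagK_monomial`;
* **`noEmbedding_F11_of_fock`**: if a `ℂ[K]`-module `N` embeds `K`-equivariantly into a product of copies of the
  Fock space, then `F_{1,1}` does not embed into `N` — because `E ∈ sl₂` has torus weight `(1,−1)` and no monomial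
  has a negative `z₂`-degree (`∀ s ∈ U(1), s^{m+1} = 1` is absurd: `eq_zero_of_forall_unitary_pow_eq_one`, via a
  primitive root of unity);
* **`noEmbedding_F00_of_jplus`**: if moreover the image lies in the `J⁺`-piece `Fock.InJplus` (`U(1)_W`-weight one:
  monomials `z^a w^e` with `|a| = e + 1`, pv12 `inJplus_support`), then `F_{0,0}` does not embed into `N` — the
  central circle of `U(2)` acts on `z^a w^e` by `s^{|a|}`, `|a| ≥ 1`;
* **`thetaPKilledByPminus_of_U2_fock`**: the X1 bridge with `h₀ h₁` DISCHARGED from such an embedding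
  `j : N →ₗ[ℂ[K]] (ι → fockRep.asModule)` — which is exactly INPUT N31 (all constituents of the closure of
  `Θ_i(χ'_i)` have archimedean component `J⁺`) composed with the PRINT Fock dictionary already carried by
  N26/N28/N33a ((F1)/(F2)/(F5): [BW VIII 2.4–2.6, 2.10, Cor 2.14; Adams 2007 Prop 6.6]; Howe duality (r1)).
  The citation [BW VI 4.11/(9)] thereby leaves the cone of N33b.

MODEL CAVEAT (DEFINITIONAL, as in `FockKTypes`): that `fockRep` IS the restriction to `K_{ι₁}` of the Fock model of
`ω` at `ι₁` is the dictionary (F1)/(F2); the normalisation "no `det`-twist on the `U(2)`-factor" is forced by PerL's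
own statement that the lowest `K_{ι₁}`-type of `J⁺` is `𝔭₊ = (1,0;−1)` (ll. 646–648; pv12 `jplus_lowest`).  With a
twist `det^α`, `α = −1`, `F_{1,1} = Sym² ⊗ det⁻¹` WOULD occur — the theorem is about the model PerL specifies.
-/

noncomputable section

namespace HodgeCM
namespace PerL34
namespace P43KTypesU2

open Matrix Complex MvPolynomial P43KTypes P43X1Bridge

/-! ## A scalar lemma: no non-trivial character of `U(1)` is identically `1` -/

/-- If `s ^ n = 1` for every `s ∈ U(1)`, then `n = 0` (test `s` = a primitive `(n+1)`-st root of unity). -/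
theorem eq_zero_of_forall_unitary_pow_eq_one {n : ℕ} (h : ∀ s : unitary ℂ, (s : ℂ) ^ n = 1) : n = 0 := by
  by_contra hn
  have hN : n + 1 ≠ 0 := Nat.succ_ne_zero n
  set ζ : ℂ := Complex.exp (2 * Real.pi * I / (n + 1 : ℕ)) with hζdef
  have hζ : IsPrimitiveRoot ζ (n + 1) := Complex.isPrimitiveRoot_exp (n + 1) hN
  have hnorm : ‖ζ‖ = 1 := hζ.norm'_eq_one hN
  have h1 : (starRingEnd ℂ) ζ * ζ = 1 := by
    rw [Complex.conj_mul', hnorm]; simp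
  have hmem : ζ ∈ unitary ℂ := by
    rw [Unitary.mem_iff]
    exact ⟨h1, by rw [mul_comm]; exact h1⟩
  have hpow : ζ ^ n = 1 := h ⟨ζ, hmem⟩
  have hdvd : n + 1 ∣ n := (hζ.pow_eq_one_iff_dvd n).mp hpow
  exact absurd (Nat.le_of_dvd (Nat.pos_of_ne_zero hn) hdvd) (by omega)

/-! ## The `K`-action on the Fock model `ℂ[z₁, z₂, w]` by substitution -/

/-- Substitution of the variables under `k = (A,d)`: `z_a ↦ Σ_b A_{ba} z_b` (the `z`'s transform like the standard
basis of `V⁺ = ℂ²`), `w ↦ d̄ w`. -/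
def substVar (k : K) : Fock.HarmVar → Fock.HarmModel
  | Sum.inl a => ∑ b : Fin 2, (mat k) b a • X (Sum.inl b)
  | Sum.inr u => star (k.2 : ℂ) • X (Sum.inr u)

/-- The substitution as a `ℂ`-algebra endomorphism of `ℂ[z₁,z₂,w]`. -/
def substHom (k : K) : Fock.HarmModel →ₐ[ℂ] Fock.HarmModel := MvPolynomial.aeval (substVar k)

/-- (Ported verbatim from the HodgeCMPerL package; no docstring in the source.) -/
@[simp] theorem substHom_X (k : K) (v : Fock.HarmVar) : substHom k (X v) = substVar k v := by
  rw [substHom, MvPolynomial.aeval_X]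

/-- (Ported verbatim from the HodgeCMPerL package; no docstring in the source.) -/
theorem substHom_one : substHom 1 = AlgHom.id ℂ Fock.HarmModel := by
  refine MvPolynomial.algHom_ext fun v => ?_
  rw [substHom_X, AlgHom.id_apply]
  rcases v with a | u
  · simp only [substVar, mat, Prod.fst_one, OneMemClass.coe_one, Fin.sum_univ_two]
    fin_cases a <;> simp [Matrix.one_apply]
  · simp [substVar]

/-- (Ported verbatim from the HodgeCMPerL package; no docstring in the source.) -/
theorem substHom_mul (k₁ k₂ : K) : substHom (k₁ * k₂) = (substHom k₁).comp (substHom k₂) := by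
  refine MvPolynomial.algHom_ext fun v => ?_
  rw [AlgHom.comp_apply, substHom_X, substHom_X]
  rcases v with a | u
  · simp only [substVar, mat, Prod.fst_mul, Submonoid.coe_mul, Fin.sum_univ_two, Matrix.mul_apply, map_add,
      map_smul, substHom_X]
    simp only [smul_add, smul_smul]
    module
  · simp only [substVar, Prod.snd_mul, Submonoid.coe_mul, map_smul, substHom_X, smul_smul, star_mul]

/-- **The `K_{ι₁} = U(2) × U(1)`-action on the Fock model** `ℂ[z₁,z₂,w]`: `(A,d)·f = d̄ · f(zA, d̄ w)` (vacuum twist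
`d̄`, weight table (F2) of `FockKTypes`). -/
def fockRep : Representation ℂ K Fock.HarmModel where
  toFun k := star (k.2 : ℂ) • (substHom k).toLinearMap
  map_one' := by
    apply LinearMap.ext
    intro f
    simp [substHom_one]
  map_mul' k₁ k₂ := by
    apply LinearMap.ext
    intro f
    have hc : substHom (k₁ * k₂) f = substHom k₁ (substHom k₂ f) := by
      rw [substHom_mul]; rfl
    simp only [LinearMap.smul_apply, AlgHom.toLinearMap_apply, Module.End.mul_apply, Prod.snd_mul,
      Submonoid.coe_mul, star_mul, map_smul, hc, smul_smul]

/-- (Ported verbatim from the HodgeCMPerL package; no docstring in the source.) -/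
@[simp] theorem fockRep_apply (k : K) (f : Fock.HarmModel) : fockRep k f = star (k.2 : ℂ) • substHom k f := rfl

/-! ## Diagonal elements act on monomials by characters -/

/-- (Ported verbatim from the HodgeCMPerL package; no docstring in the source.) -/
theorem diag_mem (s₁ s₂ : unitary ℂ) : Matrix.diagonal ![(s₁ : ℂ), s₂] ∈ Matrix.unitaryGroup (Fin 2) ℂ := by
  rw [Matrix.mem_unitaryGroup_iff]
  have h₁ : (s₁ : ℂ) * (starRingEnd ℂ) (s₁ : ℂ) = 1 := Unitary.mul_star_self_of_mem s₁.prop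
  have h₂ : (s₂ : ℂ) * (starRingEnd ℂ) (s₂ : ℂ) = 1 := Unitary.mul_star_self_of_mem s₂.prop
  ext i j
  fin_cases i <;> fin_cases j <;> simp [Matrix.mul_apply, Matrix.diagonal, Matrix.star_apply, h₁, h₂]

/-- The torus element `(diag(s₁,s₂), d) ∈ K`. -/
def diagK (s₁ s₂ d : unitary ℂ) : K := (⟨Matrix.diagonal ![(s₁ : ℂ), s₂], diag_mem s₁ s₂⟩, d)

/-- (Ported verbatim from the HodgeCMPerL package; no docstring in the source.) -/
@[simp] theorem mat_diagK (s₁ s₂ d : unitary ℂ) : mat (diagK s₁ s₂ d) = Matrix.diagonal ![(s₁ : ℂ), s₂] := rfl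
/-- (Ported verbatim from the HodgeCMPerL package; no docstring in the source.) -/
@[simp] theorem diagK_snd (s₁ s₂ d : unitary ℂ) : (diagK s₁ s₂ d).2 = d := rfl

/-- the scaling factors of the three variables under `diagK s₁ s₂ d` -/
def diagScale (s₁ s₂ d : unitary ℂ) : Fock.HarmVar → ℂ
  | Sum.inl a => ![(s₁ : ℂ), s₂] a
  | Sum.inr _ => star (d : ℂ)

/-- (Ported verbatim from the HodgeCMPerL package; no docstring in the source.) -/
theorem substVar_diagK (s₁ s₂ d : unitary ℂ) :
    substVar (diagK s₁ s₂ d) = fun v => diagScale s₁ s₂ d v • X v := by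
  funext v
  rcases v with a | u
  · simp only [substVar, mat_diagK, Fin.sum_univ_two, diagScale]
    fin_cases a <;> simp [Matrix.diagonal]
  · rfl

/-- A diagonal substitution `X_v ↦ g_v X_v` multiplies the monomial `X^m` by `∏ g_v^{m_v}`. -/
theorem aeval_scale_monomial {σ' : Type*} [Fintype σ'] (g : σ' → ℂ) (m : σ' →₀ ℕ) (c : ℂ) :
    MvPolynomial.aeval (fun v => g v • (X v : MvPolynomial σ' ℂ)) (monomial m c) =
      (∏ v, g v ^ m v) • monomial m c := by
  rw [MvPolynomial.aeval_monomial, MvPolynomial.algebraMap_eq]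
  have hprod : (m.prod fun v e => (g v • (X v : MvPolynomial σ' ℂ)) ^ e) =
      C (∏ v, g v ^ m v) * m.prod fun v e => (X v : MvPolynomial σ' ℂ) ^ e := by
    rw [Finsupp.prod_pow, Finsupp.prod_pow, map_prod, ← Finset.prod_mul_distrib]
    refine Finset.prod_congr rfl fun v _ => ?_
    rw [MvPolynomial.smul_eq_C_mul, mul_pow, map_pow]
  rw [hprod, ← mul_assoc, mul_comm (C c), mul_assoc, ← MvPolynomial.monomial_eq, MvPolynomial.C_mul']

/-- **Torus weights of monomials:** `(diag(s₁,s₂),d) · (c z₁^{m₁} z₂^{m₂} w^{e}) =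
d̄ · s₁^{m₁} s₂^{m₂} d̄^{e} · (c z₁^{m₁} z₂^{m₂} w^{e})`. -/
theorem fockRep_diagK_monomial (s₁ s₂ d : unitary ℂ) (m : Fock.HarmVar →₀ ℕ) (c : ℂ) :
    fockRep (diagK s₁ s₂ d) (monomial m c) =
      (star (d : ℂ) * ((s₁ : ℂ) ^ m (Sum.inl 0) * (s₂ : ℂ) ^ m (Sum.inl 1) *
        (star (d : ℂ)) ^ m (Sum.inr ()))) • monomial m c := by
  rw [fockRep_apply, diagK_snd, substHom, substVar_diagK, aeval_scale_monomial, smul_smul]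
  congr 2
  simp only [Fintype.prod_sum_type, Fin.prod_univ_two, Fintype.prod_unique, diagScale]
  simp

/-- Coefficientwise form of `fockRep_diagK_monomial`. -/
theorem coeff_fockRep_diagK (s₁ s₂ d : unitary ℂ) (f : Fock.HarmModel) (m : Fock.HarmVar →₀ ℕ) :
    coeff m (fockRep (diagK s₁ s₂ d) f) =
      (star (d : ℂ) * ((s₁ : ℂ) ^ m (Sum.inl 0) * (s₂ : ℂ) ^ m (Sum.inl 1) *
        (star (d : ℂ)) ^ m (Sum.inr ()))) * coeff m f := by
  classical
  refine MvPolynomial.induction_on' f (fun u a => ?_) (fun p q hp hq => ?_)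
  · rw [fockRep_diagK_monomial, MvPolynomial.coeff_smul, MvPolynomial.coeff_monomial, smul_eq_mul]
    split_ifs with h
    · subst h; rfl
    · rw [mul_zero, mul_zero]
  · rw [map_add, MvPolynomial.coeff_add, MvPolynomial.coeff_add, hp, hq, mul_add]

/-! ## `F_{1,1}` and `F_{0,0}` under the torus -/

/-- (Ported verbatim from the HodgeCMPerL package; no docstring in the source.) -/
theorem E_ne_zero : (E : V11) ≠ 0 := by
  intro h
  have := congrArg (fun v : V11 => (v : Matrix (Fin 2) (Fin 2) ℂ) 0 1) h
  simp at this

/-- `diag(s₁,s₂) E diag(s₁,s₂)* = s₁ s̄₂ E`: `E` has torus weight `(1,−1)`. -/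
theorem F11_diagK_E (s₁ s₂ d : unitary ℂ) : F11 (diagK s₁ s₂ d) E = ((s₁ : ℂ) * star (s₂ : ℂ)) • E := by
  apply Subtype.ext
  rw [F11_apply_coe, mat_diagK, E_coe, Submodule.coe_smul, E_coe]
  ext i j
  fin_cases i <;> fin_cases j <;>
    simp [Matrix.mul_apply, Fin.sum_univ_two, Matrix.diagonal, Matrix.star_apply]

/-! ## The two `K`-type exclusions -/

section NoEmbedding

variable {N : Type*} [AddCommGroup N] [Module (MonoidAlgebra ℂ K) N] {ι : Type*}

/-- **`F_{1,1}` does not occur in the Fock space** (hence not in any `ℂ[K]`-module embedding equivariantly into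
copies of it): the weight `(1,−1)` of `E ∈ sl₂` would force a monomial with `s^{m₂ + 1} = 1` for all `s ∈ U(1)`. -/
theorem noEmbedding_F11_of_fock (j : N →ₗ[MonoidAlgebra ℂ K] (ι → fockRep.asModule))
    (hj : Function.Injective j) : NoEmbedding (MonoidAlgebra ℂ K) F11.asModule N := by
  classical
  intro g hg
  -- the image of `E` is a non-zero vector; pick a coordinate where it is non-zero
  have hgE : j (g (show F11.asModule from E)) ≠ 0 := by
    intro h
    have h' : g (show F11.asModule from E) = 0 := hj (h.trans (map_zero j).symm)
    have h'' : (show F11.asModule from E) = 0 := hg (h'.trans (map_zero g).symm)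
    exact E_ne_zero h''
  obtain ⟨i, hi⟩ : ∃ i, j (g (show F11.asModule from E)) i ≠ 0 := by
    by_contra h
    push Not at h
    exact hgE (funext h)
  let gi : F11.asModule →ₗ[MonoidAlgebra ℂ K] fockRep.asModule := (LinearMap.proj i).comp (j.comp g)
  let G : Representation.IntertwiningMap F11 fockRep :=
    (Representation.IntertwiningMap.equivLinearMapAsModule F11 fockRep).symm gi
  set f : Fock.HarmModel := G.toLinearMap E with hfdef
  have hf : f ≠ 0 := hi
  -- equivariance at the torus elements `(diag(1,s), 1)`: `f` has weight `s̄`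
  have heq : ∀ s : unitary ℂ, fockRep (diagK 1 s 1) f = (star (s : ℂ)) • f := by
    intro s
    have h := congrArg (fun φ : V11 →ₗ[ℂ] Fock.HarmModel => φ E) (G.isIntertwining' (diagK 1 s 1))
    simp only [LinearMap.comp_apply] at h
    rw [F11_diagK_E, map_smul, OneMemClass.coe_one, one_mul] at h
    rw [hfdef]
    exact h.symm
  obtain ⟨m, hm⟩ := MvPolynomial.ne_zero_iff.mp hf
  have key : ∀ s : unitary ℂ, (s : ℂ) ^ (m (Sum.inl 1) + 1) = 1 := by
    intro s
    have h := congrArg (coeff m) (heq s)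
    rw [coeff_fockRep_diagK, MvPolynomial.coeff_smul, smul_eq_mul] at h
    simp only [OneMemClass.coe_one, star_one, one_pow, one_mul, mul_one] at h
    have h' : (s : ℂ) ^ m (Sum.inl 1) = star (s : ℂ) := mul_right_cancel₀ hm h
    rw [pow_succ, h', Unitary.star_mul_self_of_mem s.prop]
  exact absurd (eq_zero_of_forall_unitary_pow_eq_one key) (Nat.succ_ne_zero _)

/-- **`F_{0,0}` does not occur in the `J⁺`-piece**: a `K`-invariant vector of the `J⁺`-piece would be a sum of
monomials `z^a w^e`, `|a| = e + 1 ≥ 1`, fixed by the central circle `s ↦ s^{|a|}` of `U(2)`. -/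
theorem noEmbedding_F00_of_jplus (j : N →ₗ[MonoidAlgebra ℂ K] (ι → fockRep.asModule))
    (hj : Function.Injective j) (hJ : ∀ (n : N) (i : ι), Fock.InJplus (j n i)) :
    NoEmbedding (MonoidAlgebra ℂ K) F00.asModule N := by
  classical
  intro g hg
  have hg1 : j (g (show F00.asModule from (1 : ℂ))) ≠ 0 := by
    intro h
    have h' : g (show F00.asModule from (1 : ℂ)) = 0 := hj (h.trans (map_zero j).symm)
    have h'' : (show F00.asModule from (1 : ℂ)) = 0 := hg (h'.trans (map_zero g).symm)
    exact one_ne_zero (α := ℂ) h''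
  obtain ⟨i, hi⟩ : ∃ i, j (g (show F00.asModule from (1 : ℂ))) i ≠ 0 := by
    by_contra h
    push Not at h
    exact hg1 (funext h)
  let gi : F00.asModule →ₗ[MonoidAlgebra ℂ K] fockRep.asModule := (LinearMap.proj i).comp (j.comp g)
  let G : Representation.IntertwiningMap F00 fockRep :=
    (Representation.IntertwiningMap.equivLinearMapAsModule F00 fockRep).symm gi
  set f : Fock.HarmModel := G.toLinearMap (1 : ℂ) with hfdef
  have hf : f ≠ 0 := hi
  have hfJ : Fock.InJplus f := hJ _ i
  -- invariance under the central circle `(s·1, 1)` of `U(2)`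
  have heq : ∀ s : unitary ℂ, fockRep (diagK s s 1) f = f := by
    intro s
    have h := congrArg (fun φ : ℂ →ₗ[ℂ] Fock.HarmModel => φ 1) (G.isIntertwining' (diagK s s 1))
    simp only [LinearMap.comp_apply, F00, Representation.trivial_apply] at h
    rw [hfdef]
    exact h.symm
  obtain ⟨m, hm⟩ := MvPolynomial.ne_zero_iff.mp hf
  have hsupp : m (Sum.inl 0) + m (Sum.inl 1) = m (Sum.inr ()) + 1 :=
    Fock.inJplus_support hfJ (MvPolynomial.mem_support_iff.mpr hm)
  have key : ∀ s : unitary ℂ, (s : ℂ) ^ (m (Sum.inl 0) + m (Sum.inl 1)) = 1 := by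
    intro s
    have h := congrArg (coeff m) (heq s)
    rw [coeff_fockRep_diagK] at h
    simp only [OneMemClass.coe_one, star_one, one_pow, one_mul, mul_one] at h
    have h' : (s : ℂ) ^ m (Sum.inl 0) * (s : ℂ) ^ m (Sum.inl 1) = 1 :=
      mul_right_cancel₀ hm (by rw [h, one_mul])
    rw [pow_add, h']
  have := eq_zero_of_forall_unitary_pow_eq_one key
  omega

end NoEmbedding

/-! ## The X1 bridge with `h₀ h₁` discharged from the Fock model -/

section Bridge

variable {Ginf Gc Gf V S : Type*} [Group Gc] [Group Gf] [AddCommGroup V] [Module ℂ V]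
  [AddCommGroup S] [Module ℂ S]
  (D : P43Forms.FormsDictionary Ginf V) (M : P43Forms.ThetaKernelData Ginf Gc Gf V S)

/-- **(X1) `ThetaPKilledByPminus` for `K_{ι₁} = U(2) × U(1)`, `K`-type leaves from the Fock model.**  Remaining
hypotheses: `hQ` (DEFINITIONAL: `Q = Θ_i(χ'_i)[𝔭₊]` is `𝔭₊`-isotypic); `j`, `hj`, `hJ` — the `ℂ[K]`-module `N` of
`Θ_i(χ'_i)` embeds `K`-equivariantly into copies of the Fock space `ℂ[z₁,z₂,w]`, inside the `J⁺`-piece (INPUT N31: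
every constituent of the closure of `Θ_i(χ'_i)` has archimedean component `J⁺`; PRINT Fock dictionary (F1)/(F2)/(F5)
[BW VIII 2.4–2.6, 2.10, 2.14; Adams 2007 Prop 6.6] as in `FockKTypes`); `act`/`ι'`/`hdict`/`hCoch` — the
DEFINITIONAL slice dictionary of `P43_X1bridge`.  KERNEL: simplicity of `F_{0,0}`, `F_{1,1}` (`P43_KTypesU2`),
`hgen` (`P43_KTypesU2Gen`), `h₀ h₁` (this file). -/
theorem thetaPKilledByPminus_of_U2_fock {Q : Type*} [AddCommGroup Q] [Module ℂ Q] (σ : Representation ℂ K Q)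
    (hQ : generatedBy (MonoidAlgebra ℂ K) pPlus.asModule σ.asModule = ⊤)
    {N : Type*} [AddCommGroup N] [Module (MonoidAlgebra ℂ K) N] {ι : Type*}
    (j : N →ₗ[MonoidAlgebra ℂ K] (ι → fockRep.asModule)) (hj : Function.Injective j)
    (hJ : ∀ (n : N) (i : ι), Fock.InJplus (j n i))
    (act : (pMinus.tprod σ).asModule →ₗ[MonoidAlgebra ℂ K] N) (ι' : N →+ (Ginf → V))
    (hdict : ∀ X ∈ D.Pminus, ∀ φ ∈ M.Ptype, ∃ p : (pMinus.tprod σ).asModule,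
      X (P43Forms.uEval (M.theta φ)) = ι' (act p))
    (hCoch : ∀ φ ∈ M.Ptype, P43Forms.uEval (M.theta φ) ∈ D.Cochain) :
    P43Forms.ThetaPKilledByPminus D M :=
  thetaPKilledByPminus_of_U2 D M σ hQ (noEmbedding_F00_of_jplus j hj hJ) (noEmbedding_F11_of_fock j hj)
    act ι' hdict hCoch

end Bridge

end P43KTypesU2
end PerL34
end HodgeCM

end
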